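import Literature.MathematicalPhysics.QuantumLattice.HubbardModel
import Literature.MathematicalPhysics.QuantumLattice.HubbardWave0LiebProofs
import HarnessLib

/-!
# The spin-twisted Hubbard torus in the boost gauge

Trunk T-QLATTICE, family `hubbard`; requested by route `HubbardSuperconductivity/NodalDiracTwist`
(items `NodalDiracWeakCoupling`, `SourcedDiracPersistence`, `TwistCalibrationBdG`,
`RealCyclicOverlap`, `DiskTrivialHolonomy`, `TwistAtZero`, which all inline the same `let H`).

## Contents

* `FermionTorus.shift x μ = x + e_μ` and `FermionTorus.unshift x μ = x - e_μ` on the fermionic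
  torus `FermionTorus d L = Lex (Fin d → Fin L)` (coordinate `μ` changed by `±1` in `Fin L`, i.e.
  mod `L`), the permutation `FermionTorus.shiftEquiv μ`, and their relation to the
  nearest-neighbour graph `fermionTorusGraph d L`: for `2 ≤ L` the neighbours of `x` are exactly
  the `x ± e_μ` (`FermionTorus.adj_iff_shift_or_unshift`), the maps `μ ↦ x ± e_μ` are injective,
  and for `3 ≤ L` forward and backward neighbours are distinct (`FermionTorus.shift_ne_unshift`).
* `spinTwistedHopping L φ = Σ_x Σ_μ Σ_σ (e^{i(-1)^σ φ_μ/L} c†_{xσ} c_{x+e_μ,σ} + h.c.)` and the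
  **spin-twisted Hubbard torus in the boost gauge**
  `spinTwistedHubbardTorus L U φ = -spinTwistedHopping L φ + U Σ_x n_{x↑} n_{x↓}` on
  `(ℤ/Lℤ)²` (`t = 1`; spin `↑ = 0` boosted by `+φ/L`, `↓ = 1` by `-φ/L` on every bond), which is
  DEFINITIONALLY the `let H` inlined in the route items (`spinTwistedHubbardTorus_eq_inline`, `rfl`).
* the consistently twisted nearest-neighbour `d_{x²-y²}` pair field
  `twistedDWavePairField L φ = Σ_x Σ_μ (-1)^μ (e^{-iφ_μ/L} c_{x↑} c_{x+e_μ,↓} + e^{+iφ_μ/L} c_{x+e_μ,↑} c_{x↓})`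
  and the d-wave-sourced grand-canonical family
  `sourcedSpinTwistedHubbardTorus L U μ₀ h φ = H_L(U,φ) - μ₀ N - h (P_φ + P_φ†)` (again `rfl` to
  the inlined `let H` of `SourcedDiracPersistence` / `TwistCalibrationBdG`).

## API (all proved)

`spinTwistedHubbardTorus_isHermitian`; block structure in the `(N↑, N↓)` sectors
(`preservesSectors_spinTwistedHubbardTorus`) and hence `[H, N↑] = [H, N↓] = [H, N] = [H, S^z] = 0`
(`…_commute_sum_numberOp`, `…_commute_totalNumber`, `…_commute_spinZ`) and invariance of the joint
sectors `szSector N M` (`…_mulVec_mem_szSector`); the orbital part of the antiunitary symmetry: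
`c`, `c†` are real matrices, so entrywise complex conjugation sends `H(φ)` to `H(-φ)`
(`spinTwistedHubbardTorus_map_star`, via `spinTwistedHubbardTorus_transpose`); the sourced family is
Hermitian and reduces to `H_L(U,φ)` at `μ₀ = h = 0`. The reduction `H_L(U,0) = hubbardTorus 2 L 1 U`
for `3 ≤ L` (route item `TwistAtZero`, `spinTwistedHubbardTorus_zero`) follows from the neighbour
enumeration `FermionTorus.sum_shift_add_sum_shift_swap`.

## Not here

The spin-flip unitary `F` (`F c†_{xσ} F⁻¹ = c†_{x,1-σ}`) completing the antiunitary symmetry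
`K ∘ F`, and the large gauge transformation `exp(2πi L⁻¹ Σ_x x_μ (n_{x↑} - n_{x↓}))` conjugating
`H(φ)` to `H(φ - 2π e_μ)` (route items `RealCyclicOverlap`, spectrum `2π`-periodicity).

## Sources

Twisted boundary conditions `c†_{R+L_μ,σ} = e^{iθ^σ_μ} c†_{Rσ}` with opposite twists for the two
spins, `θ^↑ = -θ^↓` ("to preserve time-reversal invariance of the singlet pairs"):
Karakuzu–Seki–Sorella, PRB 98 (2018) 075156, Sec. II D [KarakuzuSekiSorella2018]; the boost gauge
spreads the boundary phase as `e^{iθ/L}` over every bond (Shastry–Sutherland, PRL 65 (1990) 243,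
Hubbard rings [ShastrySutherland1990]; Poilblanc 1991; twisted-boundary bundles:
Niu–Thouless–Wu 1985 [NiuThoulessWu1985]). The Hubbard model and its `U(1) × U(1)` symmetry:
Lieb, PRL 62 (1989) 1201 [LiebPRL1989]; Tasaki (2020) §10.

## Mathlib / tree search

Mathlib has no Hubbard model / Fock space; the tree's `hubbardTorus`, `hamiltonian`, `numberOp`,
`PreservesSectors`, `fermionTorusGraph` are REUSED. `twistPhase`/`twistOp` (spin systems,
`SpinFlipTwist.lean`) are unrelated names and are not touched.
-/

noncomputable section

namespace Literature.MathematicalPhysics.QuantumLattice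

open Matrix Finset HubbardWave0 Literature.Probability.LatticeModels

/-! ### Unit shifts `x ↦ x ± e_μ` on the fermionic torus -/

namespace FermionTorus

variable {d L : ℕ} [NeZero L]

/-- The forward unit shift `x ↦ x + e_μ` on the fermionic torus `(ℤ/Lℤ)^d`: coordinate `μ` is
increased by `1` in `Fin L` (i.e. modulo `L`). This is the `sh x μ` inlined in the route items.
Lieb–Wu 1968 / Tasaki (2020) §9.3 (periodic boundary conditions). [folklore] -/
def shift (x : FermionTorus d L) (μ : Fin d) : FermionTorus d L :=
  toLex (Function.update (ofLex x) μ (ofLex x μ + 1))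

/-- The backward unit shift `x ↦ x - e_μ` on the fermionic torus (coordinate `μ` decreased by `1`
modulo `L`). [folklore] -/
def unshift (x : FermionTorus d L) (μ : Fin d) : FermionTorus d L :=
  toLex (Function.update (ofLex x) μ (ofLex x μ - 1))

/-- Coordinates of `x + e_μ`. [folklore] -/
theorem ofLex_shift (x : FermionTorus d L) (μ : Fin d) :
    ofLex (shift x μ) = Function.update (ofLex x) μ (ofLex x μ + 1) := rfl

/-- Coordinates of `x - e_μ`. [folklore] -/
theorem ofLex_unshift (x : FermionTorus d L) (μ : Fin d) :
    ofLex (unshift x μ) = Function.update (ofLex x) μ (ofLex x μ - 1) := rfl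

/-- `(x + e_μ) - e_μ = x`. [folklore] -/
@[simp] theorem unshift_shift (x : FermionTorus d L) (μ : Fin d) : unshift (shift x μ) μ = x := by
  rw [unshift, ofLex_shift, Function.update_self, Function.update_idem, add_sub_cancel_right,
    Function.update_eq_self, toLex_ofLex]

/-- `(x - e_μ) + e_μ = x`. [folklore] -/
@[simp] theorem shift_unshift (x : FermionTorus d L) (μ : Fin d) : shift (unshift x μ) μ = x := by
  rw [shift, ofLex_unshift, Function.update_self, Function.update_idem, sub_add_cancel,
    Function.update_eq_self, toLex_ofLex]

/-- The shift by `e_μ` as a permutation of the torus (inverse: `unshift`). [folklore] -/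
def shiftEquiv (μ : Fin d) : FermionTorus d L ≃ FermionTorus d L where
  toFun x := shift x μ
  invFun x := unshift x μ
  left_inv x := unshift_shift x μ
  right_inv x := shift_unshift x μ

/-- `shiftEquiv μ x = x + e_μ`. [folklore] -/
@[simp] theorem shiftEquiv_apply (μ : Fin d) (x : FermionTorus d L) : shiftEquiv μ x = shift x μ :=
  rfl

/-- Under the comparison map to `(ZMod L)^d`, `x + e_μ ↦ x̄ + e_μ`. [folklore] -/
theorem toTorusSite_shift (x : FermionTorus d L) (μ : Fin d) :
    toTorusSite (shift x μ) = toTorusSite x + Pi.single μ 1 := by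
  funext i
  rw [Pi.add_apply, toTorusSite_apply, toTorusSite_apply, ofLex_shift]
  by_cases h : i = μ
  · subst h
    rw [Function.update_self, Pi.single_eq_same, Fin.val_add, ZMod.natCast_mod, Nat.cast_add,
      Fin.val_one', ZMod.natCast_mod, Nat.cast_one]
  · rw [Function.update_of_ne h, Pi.single_eq_of_ne h, add_zero]

/-- Under the comparison map to `(ZMod L)^d`, `x - e_μ ↦ x̄ - e_μ`. [folklore] -/
theorem toTorusSite_unshift (x : FermionTorus d L) (μ : Fin d) :
    toTorusSite (unshift x μ) = toTorusSite x - Pi.single μ 1 := by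
  rw [eq_sub_iff_add_eq, ← toTorusSite_shift, shift_unshift]

/-- The comparison map `FermionTorus d L → (ZMod L)^d` is injective (`L ≠ 0`). [folklore] -/
theorem toTorusSite_injective :
    Function.Injective (toTorusSite : FermionTorus d L → TorusSite d L) :=
  equivTorusSite.injective

omit [NeZero L] in
/-- For `L ≥ 2` the unit vectors `e_μ ∈ (ZMod L)^d` are pairwise distinct. [folklore] -/
theorem single_one_injective (hL : 2 ≤ L) :
    Function.Injective fun μ : Fin d => (Pi.single μ 1 : TorusSite d L) := by
  haveI : Fact (1 < L) := ⟨hL⟩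
  intro μ ν h
  by_contra hne
  have h' := congrFun h ν
  dsimp only at h'
  rw [Pi.single_eq_same, Pi.single_eq_of_ne (Ne.symm hne)] at h'
  exact zero_ne_one h'

omit [NeZero L] in
/-- For `L ≥ 2`, `e_μ ≠ 0` in `(ZMod L)^d`. [folklore] -/
theorem single_one_ne_zero (hL : 2 ≤ L) (μ : Fin d) : (Pi.single μ 1 : TorusSite d L) ≠ 0 := by
  haveI : Fact (1 < L) := ⟨hL⟩
  intro h
  have h1 : (Pi.single μ (1 : ZMod L) : TorusSite d L) μ = 0 := by rw [h, Pi.zero_apply]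
  rw [Pi.single_eq_same] at h1
  exact one_ne_zero h1

/-- `x ∼ x + e_μ` in the torus graph (`L ≥ 2`). Friedli–Velenik (2017) §3.1. [folklore] -/
theorem adj_shift (hL : 2 ≤ L) (x : FermionTorus d L) (μ : Fin d) :
    (fermionTorusGraph d L).Adj x (shift x μ) := by
  rw [fermionTorusGraph_adj, torusGraph_adj_iff, toTorusSite_shift]
  exact ⟨fun h => single_one_ne_zero hL μ (left_eq_add.1 h), Or.inl ⟨μ, rfl⟩⟩

/-- `x ∼ x - e_μ` in the torus graph (`L ≥ 2`). Friedli–Velenik (2017) §3.1. [folklore] -/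
theorem adj_unshift (hL : 2 ≤ L) (x : FermionTorus d L) (μ : Fin d) :
    (fermionTorusGraph d L).Adj x (unshift x μ) := by
  have h := adj_shift hL (unshift x μ) μ
  rw [shift_unshift] at h
  exact h.symm

/-- For `L ≥ 2` the neighbours of `x` in the torus graph are exactly the sites `x ± e_μ`.
Friedli–Velenik (2017) §3.1. [folklore] -/
theorem adj_iff_shift_or_unshift (hL : 2 ≤ L) (x y : FermionTorus d L) :
    (fermionTorusGraph d L).Adj x y ↔ (∃ μ, shift x μ = y) ∨ ∃ μ, unshift x μ = y := by
  constructor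
  · rw [fermionTorusGraph_adj, torusGraph_adj_iff]
    rintro ⟨-, ⟨i, hi⟩ | ⟨i, hi⟩⟩
    · exact Or.inl ⟨i, toTorusSite_injective (by rw [toTorusSite_shift, hi])⟩
    · exact Or.inr ⟨i, toTorusSite_injective (by rw [toTorusSite_unshift, hi, add_sub_cancel_right])⟩
  · rintro (⟨μ, rfl⟩ | ⟨μ, rfl⟩)
    · exact adj_shift hL x μ
    · exact adj_unshift hL x μ

/-- `μ ↦ x + e_μ` is injective (`L ≥ 2`). [folklore] -/
theorem shift_injective (hL : 2 ≤ L) (x : FermionTorus d L) : Function.Injective (shift x) := by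
  intro μ ν h
  have h' := congrArg toTorusSite h
  rw [toTorusSite_shift, toTorusSite_shift] at h'
  exact single_one_injective hL (add_left_cancel h')

/-- `μ ↦ x - e_μ` is injective (`L ≥ 2`). [folklore] -/
theorem unshift_injective (hL : 2 ≤ L) (x : FermionTorus d L) :
    Function.Injective (unshift x) := by
  intro μ ν h
  have h' := congrArg toTorusSite h
  rw [toTorusSite_unshift, toTorusSite_unshift] at h'
  exact single_one_injective hL (sub_right_inj.1 h')

/-- For `L ≥ 3` forward and backward neighbours differ: `x + e_μ ≠ x - e_ν` (for `L = 2` they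
coincide when `μ = ν`, the double bond of the `2 × 2` torus). [folklore] -/
theorem shift_ne_unshift (hL : 3 ≤ L) (x : FermionTorus d L) (μ ν : Fin d) :
    shift x μ ≠ unshift x ν := by
  haveI : Fact (1 < L) := ⟨by omega⟩
  intro h
  have h' := congrArg toTorusSite h
  rw [toTorusSite_shift, toTorusSite_unshift] at h'
  have e := congrFun h' μ
  rw [Pi.add_apply, Pi.sub_apply, Pi.single_eq_same] at e
  by_cases hμν : ν = μ
  · subst hμν
    rw [Pi.single_eq_same] at e
    have h2 : ((2 : ℕ) : ZMod L) = 0 := by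
      rw [Nat.cast_ofNat]
      linear_combination e
    rw [ZMod.natCast_eq_zero_iff] at h2
    have := Nat.le_of_dvd two_pos h2
    omega
  · rw [Pi.single_eq_of_ne (Ne.symm hμν), sub_zero] at e
    exact one_ne_zero (left_eq_add.1 e.symm)

/-- For `L ≥ 2`, the neighbourhood of `x` (as a filtered `Finset`) is the union of the forward
neighbours `{x + e_μ}` and the backward neighbours `{x - e_μ}` (disjoint once `L ≥ 3`). [folklore] -/
theorem filter_adj_eq_image_union (hL : 2 ≤ L) (x : FermionTorus d L) :
    (univ.filter fun y => (fermionTorusGraph d L).Adj x y) =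
      univ.image (shift x) ∪ univ.image (unshift x) := by
  ext y
  simp only [mem_filter, mem_univ, true_and, mem_union, mem_image]
  exact adj_iff_shift_or_unshift hL x y

/-- For `L ≥ 3`, `{x + e_μ}` and `{x - e_μ}` are disjoint. [folklore] -/
theorem disjoint_image_shift_unshift (hL : 3 ≤ L) (x : FermionTorus d L) :
    Disjoint (univ.image (shift x)) (univ.image (unshift x)) := by
  rw [Finset.disjoint_left]
  intro y h1 h2
  obtain ⟨μ, -, rfl⟩ := mem_image.1 h1
  obtain ⟨ν, -, h⟩ := mem_image.1 h2
  exact shift_ne_unshift hL x μ ν h.symm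

/-- **Neighbour enumeration on the torus.** For `L ≥ 3` and any bond function `T`,
`Σ_x Σ_μ (T(x, x+e_μ) + T(x+e_μ, x)) = Σ_x Σ_y [x ∼ y] T(x, y)`: summing a term and its reverse
over the `d` forward bonds at every site is the same as summing over ordered adjacent pairs of
`fermionTorusGraph d L`. (False for `L = 2`, where the left side double counts each bond.)
Friedli–Velenik (2017) §3.1. [folklore] -/
theorem sum_shift_add_sum_shift_swap {M : Type*} [AddCommMonoid M] (hL : 3 ≤ L)
    (T : FermionTorus d L → FermionTorus d L → M) :
    ∑ x, ∑ μ, (T x (shift x μ) + T (shift x μ) x) =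
      ∑ x, ∑ y, if (fermionTorusGraph d L).Adj x y then T x y else 0 := by
  have h2 : 2 ≤ L := by omega
  have hback : ∀ μ : Fin d, ∑ x, T (shift x μ) x = ∑ x, T x (unshift x μ) := fun μ => by
    rw [← Equiv.sum_comp (shiftEquiv (L := L) μ) (fun y => T y (unshift y μ))]
    simp only [shiftEquiv_apply, unshift_shift]
  have hB : ∑ x, ∑ μ, T (shift x μ) x = ∑ x : FermionTorus d L, ∑ μ, T x (unshift x μ) := by
    rw [Finset.sum_comm]
    conv_rhs => rw [Finset.sum_comm]
    exact Finset.sum_congr rfl fun μ _ => hback μ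
  simp only [Finset.sum_add_distrib]
  rw [hB, ← Finset.sum_add_distrib]
  refine Finset.sum_congr rfl fun x _ => ?_
  rw [← Finset.sum_filter, filter_adj_eq_image_union h2 x,
    Finset.sum_union (disjoint_image_shift_unshift hL x),
    Finset.sum_image fun μ _ ν _ h => shift_injective h2 x h,
    Finset.sum_image fun μ _ ν _ h => unshift_injective h2 x h]

end FermionTorus

/-! ### Real matrices: transposes of `c`, `c†`, `n` -/

section RealEntries

variable {ι : Type*} [LinearOrder ι]

/-- `c_i` has real (`±1`, `0`) entries, so its transpose is its adjoint: `(c_i)ᵀ = c†_i`.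
Tasaki (2020) §9.2 (Jordan–Wigner signs). [folklore] -/
theorem annihilation_transpose (i : ι) : (annihilation i)ᵀ = creation i := by
  ext s t
  rw [transpose_apply, annihilation_apply, creation_apply]

/-- `(c†_i)ᵀ = c_i`. Tasaki (2020) §9.2. [folklore] -/
theorem creation_transpose (i : ι) : (creation i)ᵀ = annihilation i := by
  rw [← annihilation_transpose, transpose_transpose]

end RealEntries

/-! ### The spin-twisted Hubbard torus -/

section SpinTwist

variable (L : ℕ) [NeZero L]

/-- The spin-twisted nearest-neighbour hopping on `(ℤ/Lℤ)²` in the boost gauge,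
`T_L(φ) = Σ_x Σ_{μ=0,1} Σ_{σ=0,1} (e^{i(-1)^σ φ_μ/L} c†_{xσ} c_{x+e_μ,σ} + e^{-i(-1)^σ φ_μ/L} c†_{x+e_μ,σ} c_{xσ})`:
spin `↑ = 0` picks up `+φ_μ/L` per bond in direction `μ`, spin `↓ = 1` picks up `-φ_μ/L`
(opposite twists, `θ^↑ = -θ^↓`). Karakuzu–Seki–Sorella, PRB 98 (2018) 075156, Sec. II D;
Shastry–Sutherland, PRL 65 (1990) 243. [cite: KarakuzuSekiSorella2018, Sec. II D] -/
def spinTwistedHopping (φ : Fin 2 → ℝ) :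
    Matrix (Finset (Orb (FermionTorus 2 L))) (Finset (Orb (FermionTorus 2 L))) ℂ :=
  ∑ x : FermionTorus 2 L, ∑ μ : Fin 2, ∑ σ : Fin 2,
    (Complex.exp (Complex.I * (((-1 : ℝ) ^ (σ : ℕ) * φ μ / L : ℝ) : ℂ)) •
        (creation (orb x σ) * annihilation (orb (FermionTorus.shift x μ) σ)) +
      Complex.exp (-(Complex.I * (((-1 : ℝ) ^ (σ : ℕ) * φ μ / L : ℝ) : ℂ))) •
        (creation (orb (FermionTorus.shift x μ) σ) * annihilation (orb x σ)))

/-- **The spin-twisted Hubbard torus in the boost gauge**,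
`H_L(U, φ) = -Σ_{x,μ,σ} (e^{i(-1)^σ φ_μ/L} c†_{xσ} c_{x+e_μ,σ} + h.c.) + U Σ_x n_{x↑} n_{x↓}`
on `(ℤ/Lℤ)²` with hopping amplitude `t = 1` and twist `φ ∈ ℝ²` (`↑` boosted by `+φ/L`, `↓` by
`-φ/L`). It is gauge equivalent to the Hubbard model with spin-dependent twisted boundary
conditions `c†_{x+Le_μ,σ} = e^{i(-1)^σ φ_μ} c†_{xσ}`, and equals `hubbardTorus 2 L 1 U` at `φ = 0`
for `L ≥ 3` (`spinTwistedHubbardTorus_zero`). Definitionally the `let H` inlined in the items of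
route NodalDiracTwist (`spinTwistedHubbardTorus_eq_inline`).
Karakuzu–Seki–Sorella, PRB 98 (2018) 075156, Sec. II D; Shastry–Sutherland, PRL 65 (1990) 243;
Lieb, PRL 62 (1989) 1201, eq. (1) (the model). [cite: KarakuzuSekiSorella2018, Sec. II D] -/
def spinTwistedHubbardTorus (U : ℝ) (φ : Fin 2 → ℝ) :
    Matrix (Finset (Orb (FermionTorus 2 L))) (Finset (Orb (FermionTorus 2 L))) ℂ :=
  -spinTwistedHopping L φ + (U : ℂ) • ∑ x : FermionTorus 2 L, numberOp x 0 * numberOp x 1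

/-- `spinTwistedHubbardTorus L U φ` is, by `rfl`, the `let`-expression inlined verbatim in every
item of route `HubbardSuperconductivity/NodalDiracTwist` (so those items can be restated with
`show`/`change`). [folklore] -/
theorem spinTwistedHubbardTorus_eq_inline (U : ℝ) (φ : Fin 2 → ℝ) :
    spinTwistedHubbardTorus L U φ =
      (let sh : FermionTorus 2 L → Fin 2 → FermionTorus 2 L :=
        fun x μ => toLex (Function.update (ofLex x) μ (ofLex x μ + 1))
      let a := fun (x : FermionTorus 2 L) (σ : Fin 2) => annihilation (orb x σ)
      let H := fun φ : Fin 2 → ℝ => -(∑ x : FermionTorus 2 L, ∑ μ : Fin 2, ∑ σ : Fin 2,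
          (Complex.exp (Complex.I * (((-1 : ℝ) ^ (σ : ℕ) * φ μ / L : ℝ) : ℂ)) •
              (Matrix.conjTranspose (a x σ) * a (sh x μ) σ) +
            Complex.exp (-(Complex.I * (((-1 : ℝ) ^ (σ : ℕ) * φ μ / L : ℝ) : ℂ))) •
              (Matrix.conjTranspose (a (sh x μ) σ) * a x σ))) +
        (U : ℂ) • ∑ x : FermionTorus 2 L, numberOp x 0 * numberOp x 1
      H φ) :=
  rfl

/-! #### Hermiticity -/

/-- `(e^{iθ})^* = e^{-iθ}` for real `θ`. [folklore] -/
theorem star_exp_I_mul_ofReal (r : ℝ) :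
    star (Complex.exp (Complex.I * (r : ℂ))) = Complex.exp (-(Complex.I * (r : ℂ))) := by
  rw [Complex.star_def, ← Complex.exp_conj, map_mul, Complex.conj_I, Complex.conj_ofReal, neg_mul]

/-- `(e^{-iθ})^* = e^{iθ}` for real `θ`. [folklore] -/
theorem star_exp_neg_I_mul_ofReal (r : ℝ) :
    star (Complex.exp (-(Complex.I * (r : ℂ)))) = Complex.exp (Complex.I * (r : ℂ)) := by
  rw [Complex.star_def, ← Complex.exp_conj, map_neg, map_mul, Complex.conj_I, Complex.conj_ofReal,
    neg_mul, neg_neg]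

/-- The twisted hopping term is Hermitian: each bond term comes with its adjoint.
Lieb, PRL 62 (1989) 1201, eq. (1). [folklore] -/
theorem spinTwistedHopping_conjTranspose (φ : Fin 2 → ℝ) :
    (spinTwistedHopping L φ)ᴴ = spinTwistedHopping L φ := by
  unfold spinTwistedHopping
  simp only [conjTranspose_sum, conjTranspose_add, conjTranspose_smul, conjTranspose_mul,
    creation_conjTranspose, annihilation_conjTranspose, star_exp_I_mul_ofReal,
    star_exp_neg_I_mul_ofReal]
  exact Finset.sum_congr rfl fun x _ => Finset.sum_congr rfl fun μ _ =>
    Finset.sum_congr rfl fun σ _ => add_comm _ _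

/-- The on-site interaction `Σ_x n_{x↑} n_{x↓}` is Hermitian (`n_{x↑}`, `n_{x↓}` are commuting
Hermitian projections). Lieb, PRL 62 (1989) 1201, eq. (1). [folklore] -/
theorem sum_numberOp_mul_numberOp_conjTranspose {Λ : Type*} [LinearOrder Λ] [Fintype Λ] :
    (∑ x : Λ, (numberOp x 0 * numberOp x 1 : Matrix (Finset (Orb Λ)) (Finset (Orb Λ)) ℂ))ᴴ =
      ∑ x : Λ, numberOp x 0 * numberOp x 1 := by
  rw [conjTranspose_sum]
  refine Finset.sum_congr rfl fun x _ => ?_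
  rw [conjTranspose_mul]
  change (numberAt (orb x 1))ᴴ * (numberAt (orb x 0))ᴴ = _
  rw [(numberAt_isHermitian _).eq, (numberAt_isHermitian _).eq]
  exact (numberAt_commute _ _).eq

/-- `H_L(U, φ)` is Hermitian for real `U`, `φ`. Lieb, PRL 62 (1989) 1201, eq. (1);
Karakuzu–Seki–Sorella (2018) Sec. II D. [folklore] -/
theorem spinTwistedHubbardTorus_isHermitian (U : ℝ) (φ : Fin 2 → ℝ) :
    (spinTwistedHubbardTorus L U φ).IsHermitian := by
  rw [IsHermitian, spinTwistedHubbardTorus, conjTranspose_add, conjTranspose_neg,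
    conjTranspose_smul, spinTwistedHopping_conjTranspose, sum_numberOp_mul_numberOp_conjTranspose,
    Complex.star_def, Complex.conj_ofReal]

/-! #### Conservation of `N↑`, `N↓` (hence of `N` and `S^z`) -/

/-- Negatives of sector-preserving matrices preserve sectors. [folklore] -/
theorem PreservesSectors.neg {Λ : Type*} [LinearOrder Λ] [Fintype Λ]
    {M : Matrix (Finset (Orb Λ)) (Finset (Orb Λ)) ℂ} (hM : PreservesSectors M) :
    PreservesSectors (-M) :=
  fun s s' h => hM s s' fun h' => h (by rw [Matrix.neg_apply, h', neg_zero])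

/-- A sector-preserving matrix maps `N`-particle vectors to `N`-particle vectors. [folklore] -/
theorem PreservesSectors.isNParticle_mulVec {Λ : Type*} [LinearOrder Λ] [Fintype Λ]
    {M : Matrix (Finset (Orb Λ)) (Finset (Orb Λ)) ℂ} (hM : PreservesSectors M) {N : ℕ}
    {ψ : Fock (Orb Λ)} (hψ : IsNParticle N ψ) : IsNParticle N (M *ᵥ ψ) := by
  intro s hs
  rw [Matrix.mulVec, dotProduct]
  refine Finset.sum_eq_zero fun t _ => ?_
  by_cases hMt : M s t = 0
  · rw [hMt, zero_mul]
  · rw [hψ t ?_, mul_zero]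
    intro ht
    apply hs
    rw [card_eq_upPart_add_downPart, (hM s t hMt).1, (hM s t hMt).2,
      ← card_eq_upPart_add_downPart, ht]

/-- The twisted hopping conserves `N↑` and `N↓` (it is a sum of spin-diagonal hoppings).
Lieb, PRL 62 (1989) 1201, Remark (2)(i). [folklore] -/
theorem preservesSectors_spinTwistedHopping (φ : Fin 2 → ℝ) :
    PreservesSectors (spinTwistedHopping L φ) :=
  PreservesSectors.sum fun x _ => PreservesSectors.sum fun _ _ => PreservesSectors.sum fun σ _ =>
    ((LiebThm1.preservesSectors_hopping x _ σ).smul _).add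
      ((LiebThm1.preservesSectors_hopping _ x σ).smul _)

/-- `H_L(U, φ)` conserves `N↑` and `N↓`: it is block diagonal in the sectors `(N↑, N↓)`.
Lieb, PRL 62 (1989) 1201, Remark (2)(i). [folklore] -/
theorem preservesSectors_spinTwistedHubbardTorus (U : ℝ) (φ : Fin 2 → ℝ) :
    PreservesSectors (spinTwistedHubbardTorus L U φ) :=
  (preservesSectors_spinTwistedHopping L φ).neg.add
    (PreservesSectors.smul (PreservesSectors.sum fun x _ =>
      (LiebThm1.preservesSectors_numberOp x 0).mul (LiebThm1.preservesSectors_numberOp x 1)) _)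

/-- `N↑ = Σ_x n_{x↑}` is diagonal with eigenvalue `#(up part of s)` on `|s⟩`. [folklore] -/
theorem sum_numberOp_zero_eq_diagonal {Λ : Type*} [LinearOrder Λ] [Fintype Λ] :
    (∑ x : Λ, numberOp x 0 : Matrix (Finset (Orb Λ)) (Finset (Orb Λ)) ℂ) =
      diagonal fun s => ((upPart s).card : ℂ) := by
  ext s t
  simp only [Matrix.sum_apply, LiebThm1.numberOp_eq_diagonal, diagonal_apply]
  by_cases h : s = t
  · subst h
    simp only [if_true]
    rw [Finset.sum_boole]
    rfl
  · simp [h]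

/-- `N↓ = Σ_x n_{x↓}` is diagonal with eigenvalue `#(down part of s)` on `|s⟩`. [folklore] -/
theorem sum_numberOp_one_eq_diagonal {Λ : Type*} [LinearOrder Λ] [Fintype Λ] :
    (∑ x : Λ, numberOp x 1 : Matrix (Finset (Orb Λ)) (Finset (Orb Λ)) ℂ) =
      diagonal fun s => ((downPart s).card : ℂ) := by
  ext s t
  simp only [Matrix.sum_apply, LiebThm1.numberOp_eq_diagonal, diagonal_apply]
  by_cases h : s = t
  · subst h
    simp only [if_true]
    rw [Finset.sum_boole]
    rfl
  · simp [h]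

/-- `[H_L(U,φ), N_σ] = 0` for `N_σ = Σ_x n_{xσ}`, `σ ∈ {↑, ↓}`. Lieb, PRL 62 (1989) 1201,
Remark (2)(i). [folklore] -/
theorem spinTwistedHubbardTorus_commute_sum_numberOp (U : ℝ) (φ : Fin 2 → ℝ) (σ : Fin 2) :
    Commute (spinTwistedHubbardTorus L U φ) (∑ x : FermionTorus 2 L, numberOp x σ) := by
  have hP := preservesSectors_spinTwistedHubbardTorus L U φ
  obtain ⟨_ | _ | n, hn⟩ := σ
  · rw [show (⟨0, hn⟩ : Fin 2) = 0 from rfl, sum_numberOp_zero_eq_diagonal]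
    exact hP.commute_diagonal fun a _ => (a : ℂ)
  · rw [show (⟨1, hn⟩ : Fin 2) = 1 from rfl, sum_numberOp_one_eq_diagonal]
    exact hP.commute_diagonal fun _ b => (b : ℂ)
  · omega

/-- `[H_L(U,φ), N] = 0`. Lieb, PRL 62 (1989) 1201, eqs. (1)–(2). [folklore] -/
theorem spinTwistedHubbardTorus_commute_totalNumber (U : ℝ) (φ : Fin 2 → ℝ) :
    Commute (spinTwistedHubbardTorus L U φ) totalNumber := by
  rw [LiebThm1.totalNumber_eq_diagonal]
  exact (preservesSectors_spinTwistedHubbardTorus L U φ).commute_diagonal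
    fun a b => ((a + b : ℕ) : ℂ)

/-- `[H_L(U,φ), S^z] = 0`. Lieb, PRL 62 (1989) 1201, eqs. (1)–(2). [folklore] -/
theorem spinTwistedHubbardTorus_commute_spinZ (U : ℝ) (φ : Fin 2 → ℝ) :
    Commute (spinTwistedHubbardTorus L U φ) spinZ := by
  rw [LiebThm1.spinZ_eq_diagonal]
  exact (preservesSectors_spinTwistedHubbardTorus L U φ).commute_diagonal
    fun a b => (1 / 2 : ℂ) * ((a : ℂ) - (b : ℂ))

/-- `H_L(U,φ)` maps the joint sector `(N, S^z = M)` (`szSector N M`) to itself. Lieb, PRL 62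
(1989) 1201, Remark (2)(i). [folklore] -/
theorem spinTwistedHubbardTorus_mulVec_mem_szSector (U : ℝ) (φ : Fin 2 → ℝ) {N : ℕ} {M : ℝ}
    {ψ : Fock (Orb (FermionTorus 2 L))} (hψ : ψ ∈ szSector N M) :
    spinTwistedHubbardTorus L U φ *ᵥ ψ ∈ szSector N M := by
  rw [mem_szSector_iff] at hψ ⊢
  refine ⟨(preservesSectors_spinTwistedHubbardTorus L U φ).isNParticle_mulVec hψ.1, ?_⟩
  rw [Matrix.mulVec_mulVec, ← (spinTwistedHubbardTorus_commute_spinZ L U φ).eq,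
    ← Matrix.mulVec_mulVec, hψ.2, Matrix.mulVec_smul]

/-! #### Reality: entrywise conjugation reverses the twist -/

/-- `(n_{x↑} n_{x↓})ᵀ = n_{x↑} n_{x↓}` (diagonal, commuting factors). [folklore] -/
theorem numberOp_mul_numberOp_transpose {Λ : Type*} [LinearOrder Λ] [Fintype Λ] (x : Λ) :
    (numberOp x 0 * numberOp x 1 : Matrix (Finset (Orb Λ)) (Finset (Orb Λ)) ℂ)ᵀ =
      numberOp x 0 * numberOp x 1 := by
  rw [transpose_mul, LiebThm1.numberOp_eq_diagonal, LiebThm1.numberOp_eq_diagonal,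
    diagonal_transpose, diagonal_transpose, diagonal_mul_diagonal, diagonal_mul_diagonal]
  exact congrArg diagonal (funext fun s => mul_comm _ _)

/-- `N† = N`. [folklore] -/
theorem totalNumber_conjTranspose {Λ : Type*} [LinearOrder Λ] [Fintype Λ] :
    (totalNumber : Matrix (Finset (Orb Λ)) (Finset (Orb Λ)) ℂ)ᴴ = totalNumber := by
  rw [LiebThm1.totalNumber_eq_diagonal, diagonal_conjTranspose]
  exact congrArg diagonal (funext fun s => by simp)

/-- `H_L(U,φ)ᵀ = H_L(U,-φ)`: transposition swaps `c†_{xσ} c_{yσ} ↔ c†_{yσ} c_{xσ}` (the Jordan–Wigner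
matrices are real), i.e. reverses every bond, which is the same as `φ ↦ -φ`.
Hatsugai, J. Phys. Soc. Jpn. 75 (2006) 123601 (antiunitary symmetry and reality). [folklore] -/
theorem spinTwistedHubbardTorus_transpose (U : ℝ) (φ : Fin 2 → ℝ) :
    (spinTwistedHubbardTorus L U φ)ᵀ = spinTwistedHubbardTorus L U (-φ) := by
  have hV : (∑ x : FermionTorus 2 L,
      (numberOp x 0 * numberOp x 1 : Matrix _ (Finset (Orb (FermionTorus 2 L))) ℂ))ᵀ =
      ∑ x : FermionTorus 2 L, numberOp x 0 * numberOp x 1 := by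
    rw [transpose_sum]
    exact Finset.sum_congr rfl fun x _ => numberOp_mul_numberOp_transpose x
  unfold spinTwistedHubbardTorus spinTwistedHopping
  rw [transpose_add, transpose_neg, transpose_smul, hV]
  simp only [transpose_sum, transpose_add, transpose_smul, transpose_mul, creation_transpose,
    annihilation_transpose, Pi.neg_apply, mul_neg, neg_div, Complex.ofReal_neg, neg_neg]
  congr 1
  rw [neg_inj]
  exact Finset.sum_congr rfl fun x _ => Finset.sum_congr rfl fun μ _ =>
    Finset.sum_congr rfl fun σ _ => add_comm _ _

/-- **Reality up to twist reversal.** Entrywise complex conjugation `K` in the occupation basis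
maps `H_L(U,φ)` to `H_L(U,-φ)` (`c`, `c†`, `n` are real matrices and `K e^{iθ} = e^{-iθ}`); composed
with the spin flip `↑ ↔ ↓` (which also reverses the spin twist) this is the antiunitary symmetry
`T = K ∘ F`, `T² = 1`, of route item `RealCyclicOverlap`. Hatsugai, J. Phys. Soc. Jpn. 75 (2006)
123601. [folklore] -/
theorem spinTwistedHubbardTorus_map_star (U : ℝ) (φ : Fin 2 → ℝ) :
    (spinTwistedHubbardTorus L U φ).map star = spinTwistedHubbardTorus L U (-φ) := by
  have h := (spinTwistedHubbardTorus_isHermitian L U (-φ)).eq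
  nth_rw 1 [← spinTwistedHubbardTorus_transpose] at h
  rw [conjTranspose, transpose_transpose] at h
  exact h

/-! #### The untwisted point `φ = 0` -/

/-- Cyclic commutation of a triple sum over finite types. [folklore] -/
theorem sum_comm_three {α β γ M : Type*} [Fintype α] [Fintype β] [Fintype γ] [AddCommMonoid M]
    (f : α → β → γ → M) : ∑ a, ∑ b, ∑ c, f a b c = ∑ c, ∑ a, ∑ b, f a b c :=
  (Finset.sum_congr rfl fun _ _ => Finset.sum_comm).trans Finset.sum_comm

/-- At `φ = 0` (all phases `e^0 = 1`) and `L ≥ 3` the twisted hopping is the torus hopping of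
`Literature.MathematicalPhysics.QuantumLattice.hamiltonian` summed over ordered adjacent pairs of
`fermionTorusGraph 2 L` (for `L = 2` the left side double counts the bonds). Lieb, PRL 62 (1989)
1201, eq. (1); Tasaki (2020) §10. [folklore] -/
theorem spinTwistedHopping_zero (hL : 3 ≤ L) :
    spinTwistedHopping L 0 = ∑ x : FermionTorus 2 L, ∑ y : FermionTorus 2 L, ∑ σ : Fin 2,
      if (fermionTorusGraph 2 L).Adj x y then creation (orb x σ) * annihilation (orb y σ)
      else 0 := by
  unfold spinTwistedHopping
  simp only [Pi.zero_apply, mul_zero, zero_div, Complex.ofReal_zero, neg_zero,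
    Complex.exp_zero, one_smul]
  refine (sum_comm_three _).trans (Eq.trans ?_ (sum_comm_three _).symm)
  exact Finset.sum_congr rfl fun σ _ => FermionTorus.sum_shift_add_sum_shift_swap hL
    fun x y => creation (orb x σ) * annihilation (orb y σ)

/-- **The untwisted point** (route item `TwistAtZero`): for `L ≥ 3`,
`H_L(U, 0) = hubbardTorus 2 L 1 U`, the Hubbard Hamiltonian of the Statement with `t = 1`.
Lieb, PRL 62 (1989) 1201, eq. (1); Tasaki (2020) §10. [folklore] -/
theorem spinTwistedHubbardTorus_zero (hL : 3 ≤ L) (U : ℝ) :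
    spinTwistedHubbardTorus L U 0 = hubbardTorus 2 L 1 U := by
  rw [spinTwistedHubbardTorus, spinTwistedHopping_zero L hL, hubbardTorus, hamiltonian,
    Complex.ofReal_one, neg_smul, one_smul]

/-! ### The twisted d-wave pair field and the sourced family -/

/-- The **consistently twisted nearest-neighbour `d_{x²-y²}` pair field** in the boost gauge,
`P_φ = Σ_x Σ_{μ=0,1} (-1)^μ (e^{-iφ_μ/L} c_{x↑} c_{x+e_μ,↓} + e^{+iφ_μ/L} c_{x+e_μ,↑} c_{x↓})`
(`= Σ_k 2(cos(k_x+φ_x/L) - cos(k_y+φ_y/L)) c_{k↑} c_{-k↓}`: under opposite spin twists the pairs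
stay at zero total momentum). Definitionally the `let P` of route items `SourcedDiracPersistence`,
`TwistCalibrationBdG`. Karakuzu–Seki–Sorella, PRB 98 (2018) 075156, Sec. II B–D (pairing under
grand-canonical twisted boundary conditions). [cite: KarakuzuSekiSorella2018, Sec. II D] -/
def twistedDWavePairField (φ : Fin 2 → ℝ) :
    Matrix (Finset (Orb (FermionTorus 2 L))) (Finset (Orb (FermionTorus 2 L))) ℂ :=
  ∑ x : FermionTorus 2 L, ∑ μ : Fin 2, ((-1 : ℂ) ^ (μ : ℕ)) •
    (Complex.exp (-(Complex.I * ((φ μ / L : ℝ) : ℂ))) •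
        (annihilation (orb x 0) * annihilation (orb (FermionTorus.shift x μ) 1)) +
      Complex.exp (Complex.I * ((φ μ / L : ℝ) : ℂ)) •
        (annihilation (orb (FermionTorus.shift x μ) 0) * annihilation (orb x 1)))

/-- The **d-wave-sourced, grand-canonical spin-twisted family**
`H_L(U,φ) - μ₀ N - h (P_φ + P_φ†)` (chemical potential `μ₀`, pair source `h`). Definitionally the
`let H` of route items `SourcedDiracPersistence` / `TwistCalibrationBdG`
(`sourcedSpinTwistedHubbardTorus_eq_inline`). Karakuzu–Seki–Sorella, PRB 98 (2018) 075156,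
Sec. II B–D. [cite: KarakuzuSekiSorella2018, Sec. II D] -/
def sourcedSpinTwistedHubbardTorus (U μ₀ h : ℝ) (φ : Fin 2 → ℝ) :
    Matrix (Finset (Orb (FermionTorus 2 L))) (Finset (Orb (FermionTorus 2 L))) ℂ :=
  spinTwistedHubbardTorus L U φ - (μ₀ : ℂ) • totalNumber -
    (h : ℂ) • (twistedDWavePairField L φ + (twistedDWavePairField L φ)ᴴ)

/-- `sourcedSpinTwistedHubbardTorus L U μ₀ h φ` is, by `rfl`, the `let`-expression inlined in
route items `SourcedDiracPersistence` and (with `U = 0`) `TwistCalibrationBdG`. [folklore] -/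
theorem sourcedSpinTwistedHubbardTorus_eq_inline (U μ₀ h : ℝ) (φ : Fin 2 → ℝ) :
    sourcedSpinTwistedHubbardTorus L U μ₀ h φ =
      (let sh : FermionTorus 2 L → Fin 2 → FermionTorus 2 L :=
        fun x μ => toLex (Function.update (ofLex x) μ (ofLex x μ + 1))
      let a := fun (x : FermionTorus 2 L) (σ : Fin 2) => annihilation (orb x σ)
      let H₀ := fun φ : Fin 2 → ℝ => -(∑ x : FermionTorus 2 L, ∑ μ : Fin 2, ∑ σ : Fin 2,
          (Complex.exp (Complex.I * (((-1 : ℝ) ^ (σ : ℕ) * φ μ / L : ℝ) : ℂ)) •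
              (Matrix.conjTranspose (a x σ) * a (sh x μ) σ) +
            Complex.exp (-(Complex.I * (((-1 : ℝ) ^ (σ : ℕ) * φ μ / L : ℝ) : ℂ))) •
              (Matrix.conjTranspose (a (sh x μ) σ) * a x σ))) +
        (U : ℂ) • ∑ x : FermionTorus 2 L, numberOp x 0 * numberOp x 1
      let P := fun φ : Fin 2 → ℝ => ∑ x : FermionTorus 2 L, ∑ μ : Fin 2, ((-1 : ℂ) ^ (μ : ℕ)) •
          (Complex.exp (-(Complex.I * ((φ μ / L : ℝ) : ℂ))) • (a x 0 * a (sh x μ) 1) +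
            Complex.exp (Complex.I * ((φ μ / L : ℝ) : ℂ)) • (a (sh x μ) 0 * a x 1))
      let H := fun φ : Fin 2 → ℝ =>
        H₀ φ - (μ₀ : ℂ) • totalNumber - (h : ℂ) • (P φ + Matrix.conjTranspose (P φ))
      H φ) :=
  rfl

/-- Without chemical potential and source the family is `H_L(U,φ)`. [folklore] -/
@[simp] theorem sourcedSpinTwistedHubbardTorus_zero_zero (U : ℝ) (φ : Fin 2 → ℝ) :
    sourcedSpinTwistedHubbardTorus L U 0 0 φ = spinTwistedHubbardTorus L U φ := by
  simp [sourcedSpinTwistedHubbardTorus]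

/-- The sourced family is Hermitian (`P_φ + P_φ†` is). Karakuzu–Seki–Sorella (2018) Sec. II B.
[folklore] -/
theorem sourcedSpinTwistedHubbardTorus_isHermitian (U μ₀ h : ℝ) (φ : Fin 2 → ℝ) :
    (sourcedSpinTwistedHubbardTorus L U μ₀ h φ).IsHermitian := by
  rw [IsHermitian, sourcedSpinTwistedHubbardTorus, conjTranspose_sub, conjTranspose_sub,
    conjTranspose_smul, conjTranspose_smul, conjTranspose_add, conjTranspose_conjTranspose,
    (spinTwistedHubbardTorus_isHermitian L U φ).eq, totalNumber_conjTranspose,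
    add_comm (twistedDWavePairField L φ)ᴴ,
    Complex.star_def, Complex.conj_ofReal, Complex.conj_ofReal]

end SpinTwist

end Literature.MathematicalPhysics.QuantumLattice
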